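import Summits.BirchSwinnertonDyer.BirchSwinnertonDyer.Theses.PAdicOrderV2
import Literature.NumberTheory.EllipticCurves.BSDAnalyticRankTunnellCMProofs
import Literature.NumberTheory.EllipticCurves.OrdinaryPrimesProofs

/-!
# `PAdicOrderPadicBSDrankR2` (crux stmt-BirchSwinnertonDyer-0490, routes `PAdicOrderV2` / `PAdicOrder`):
# the hypothesis `IsNewformOf W f` is load-bearing — with it dropped the statement is FALSE
# (negative-side support, refuter crux-disprover seat; this file does NOT refute the crux)

The crux says: for every elliptic `W/ℚ` (globally minimal), every good ordinary prime `p` and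
every `f ∈ S₂(Γ₀(N))` with `IsNewformOf W f`, `ord_{T=0} L_p(f, unitRoot W p, T) = rank_ℤ W(ℚ)`
in `ℕ∞`.

Here we record, sorry-free and unconditionally, that the newform hypothesis cannot be dropped:

* `padicLFunction_zero_form` — the Mazur–Swinnerton-Dyer / Mazur–Tate–Teitelbaum `p`-adic
  `L`-function of the ZERO cusp form is the zero power series, for every `α` (all its modular
  symbols vanish, hence the rational plus symbols `[r]⁺`, the measure `μ_{0,α}`, every Riemann sum
  and every coefficient `= limUnder` of the constant sequence `0`);
* `pAdicOrderPadicBSDrankR2_false_without_isNewformOf` — hence the crux with `IsNewformOf W f`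
  deleted (stated inline; no proposition is defined under `Summits/`) fails: witness the congruent
  number curve `E₁ : y² = x³ - x` (Cremona 32a2; elliptic and globally minimal by the tree theorems
  `isElliptic_congruentNumberCurve`, `isGloballyMinimal_congruentNumberCurve`), any of its good
  ordinary primes (one `≥ 5` exists: `WeierstrassCurve.exists_good_ordinary_prime_holds`) and
  `f = 0 ∈ S₂(Γ₀(1))`: the order of `0 ∈ ℚ_p⟦T⟧` is `⊤`, not a natural number.

Moral for provers: the `ℕ∞`-valued conclusion silently contains `L_p ≠ 0` (Rohrlich; in the tree
`padicLFunction_unitRoot_ne_zero`, whose proof uses `IsNewformOf` essentially), so no argument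
that is insensitive to WHICH cusp form `f` is can reach the crux.
-/

noncomputable section

-- D-0017: single-problem summit, so `Summit.BirchSwinnertonDyer.BirchSwinnertonDyer.…` repeats a
-- namespace BY DESIGN.
set_option linter.dupNamespace false

namespace Summit.BirchSwinnertonDyer.BirchSwinnertonDyer.Theorems.PAdicOrderPadicBSDrankR2.Negative

open scoped MatrixGroups ModularForm
open Filter Topology
open CongruenceSubgroup Literature.NumberTheory.EllipticCurves
  Literature.NumberTheory.EllipticCurves.ModularForms

variable {N : ℕ} {p : ℕ} [Fact p.Prime]

/-- The modular symbols `{∞, r}` of the zero cusp form vanish. [folklore] -/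
theorem modularSymbol_zero_form (r : ℚ) : modularSymbol (0 : CuspForm (Gamma0 N) 2) r = 0 := by
  simp [modularSymbol]

/-- The normalised plus symbol `[r]⁺` of the zero form vanishes (whatever its junk period is:
`0 / x = 0`). [folklore] -/
theorem normalizedPlusSymbol_zero_form (r : ℚ) :
    normalizedPlusSymbol (0 : CuspForm (Gamma0 N) 2) r = 0 := by
  simp [normalizedPlusSymbol, plusSymbol, modularSymbol_zero_form]

/-- The rational plus symbol of the zero form vanishes. [folklore] -/
theorem ratPlusSymbol_zero_form (r : ℚ) : ratPlusSymbol (0 : CuspForm (Gamma0 N) 2) r = 0 := by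
  have hex : ∃ q : ℚ, (q : ℝ) = normalizedPlusSymbol (0 : CuspForm (Gamma0 N) 2) r :=
    ⟨0, by rw [normalizedPlusSymbol_zero_form, Rat.cast_zero]⟩
  rw [ratPlusSymbol, dif_pos hex]
  exact_mod_cast (hex.choose_spec.trans (normalizedPlusSymbol_zero_form r) :
    ((hex.choose : ℚ) : ℝ) = 0)

/-- The Mazur–Swinnerton-Dyer measure `μ_{0,α}` of the zero form vanishes identically. [folklore] -/
theorem msdMeasure_zero_form (α : ℚ_[p]) (n : ℕ) (a : ZMod (p ^ n)) :
    msdMeasure (0 : CuspForm (Gamma0 N) 2) α n a = 0 := by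
  cases n with
  | zero => simp [msdMeasure, ratPlusSymbol_zero_form]
  | succ n => simp [msdMeasure, ratPlusSymbol_zero_form]

/-- **`L_p(0, α, T) = 0`** in `ℚ_p⟦T⟧`, for every `α ∈ ℚ_p`: every Riemann sum of every coefficient
is `0`, and `limUnder atTop` of the constant sequence `0` is `0`. [folklore] -/
theorem padicLFunction_zero_form (α : ℚ_[p]) : padicLFunction (0 : CuspForm (Gamma0 N) 2) α = 0 := by
  ext k
  simp only [coeff_padicLFunction, map_zero]
  unfold padicLCoeff
  have h : padicLRiemannSum (0 : CuspForm (Gamma0 N) 2) α k = fun _ ↦ 0 := by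
    funext n
    unfold padicLRiemannSum
    simp [msdMeasure_zero_form]
  rw [h]
  exact tendsto_const_nhds.limUnder_eq

/-- **`IsNewformOf` is load-bearing for `PAdicOrderPadicBSDrankR2`.** The crux with the hypothesis
`IsNewformOf W f` deleted is false: at `W = E₁ : y² = x³ - x` (elliptic, globally minimal), any
good ordinary prime `p` of `E₁` (exists, `≥ 5`) and the zero form `f = 0 ∈ S₂(Γ₀(1))`, the order of
`L_p(0, α, T) = 0` is `⊤ ≠ rank`. [folklore] -/
theorem pAdicOrderPadicBSDrankR2_false_without_isNewformOf :
    ¬ (∀ (W : WeierstrassCurve ℚ) [W.IsElliptic] [W.IsGloballyMinimal] (p : ℕ) [Fact p.Prime],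
        IsOrdinaryAt W p → ∀ {N : ℕ} [NeZero N] (f : CuspForm (Gamma0 N) 2),
          (padicLFunction f (unitRoot W p : ℚ_[p])).order = W.mordellWeilRank) := by
  intro h
  haveI : (congruentNumberCurve 1).IsElliptic := isElliptic_congruentNumberCurve one_ne_zero
  haveI : (congruentNumberCurve 1).IsGloballyMinimal :=
    isGloballyMinimal_congruentNumberCurve squarefree_one
  obtain ⟨p, hp, -, hgood, hord⟩ :=
    WeierstrassCurve.exists_good_ordinary_prime_holds (congruentNumberCurve 1)
  haveI : NeZero (1 : ℕ) := ⟨one_ne_zero⟩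
  have h1 := h (congruentNumberCurve 1) p ⟨hgood, hord⟩ (N := 1) (0 : CuspForm (Gamma0 1) 2)
  rw [padicLFunction_zero_form, PowerSeries.order_zero] at h1
  exact ENat.top_ne_coe _ h1

end Summit.BirchSwinnertonDyer.BirchSwinnertonDyer.Theorems.PAdicOrderPadicBSDrankR2.Negative

end
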